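import Mathlib
import Literature.AlgebraicGeometry.Resolution.WeightedResolutionDatum
import Summits.ResolutionOfSingularities.ResolutionOfSingularities.Theses.WeightedInvariant
import Summits.ResolutionOfSingularities.ResolutionOfSingularities.Theorems.WeightedInvariantTermination

/-!
# `WeightedInvariant.DatumToEmbedded`: the resolved case and the maximum of the invariant

Route `ResolutionOfSingularities/WeightedInvariant`, support item `DatumToEmbedded`
(stmt-ResolutionOfSingularities-0572): `Nonempty (WeightedResolutionDatum p)` ⇒ every integral closed
subscheme `X` of a smooth separated quasi-compact `Y` over a perfect field of characteristic `p` has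
a resolution.  This file lands the two datum-side ingredients of the well-founded induction on
`max inv` that do not involve the cobordant blow-up:

* **the dictionary closed immersion ↔ ideal sheaf.** The datum speaks about an ideal sheaf
  `I : Y.IdealSheafData` and the stalks of Mathlib's `I.subscheme`; the item about a closed immersion
  `i : X ⟶ Y`.  With `I := i.ker`, Mathlib's `i.toImage : X ⟶ i.ker.subscheme` is an isomorphism, so
  `X` is regular iff every stalk of `i.ker.subscheme` is (`isRegular_iff_isRegular_image`);
* **the resolved case** (`isRegular_iff_forall_isBot_inv`, `hasResolution_of_forall_isBot_inv`):
  by axiom `(ii)` of the datum, `inv` is everywhere minimal on `(Y, i.ker)` iff `X` is regular, and a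
  regular scheme is its own resolution (`Scheme.IsRegular.hasResolution`); contrapositively a
  non-regular `X` switches on the guard `∃ y, ¬ IsBot (inv y)` of axioms `(iii)`/`(iv)`
  (`exists_not_isBot_inv_of_not_isRegular`);
* **the maximum locus is non-empty** (`isNoetherian_of_smooth_quasiCompact`, `finite_range_inv`,
  `exists_isMax_inv`): `Y` is a Noetherian scheme (finite type over a field), so the upper
  semicontinuous `inv` takes finitely many values and attains its maximum
  (`Literature.AlgGeom.finite_range_of_isClosed_superlevel`, Theorems/WeightedInvariantTermination);
* **the induction engine** (`WeightedResolutionDatum.maxinv_induction`): a property of pairs that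
  holds in the resolved case and climbs one step of `max inv` holds always — well-founded induction
  on `max inv ∈ D.Γ`, packaged once so that the remaining work on the item is exactly the STEP
  (cobordant blow-up of the maximum locus, axiom `(iv)`) and the final torus-quotient descent.

All proofs are glue on Mathlib and the tree; no named facts.
-/

set_option linter.dupNamespace false -- mandated namespace of this single-conjunct summit

namespace Summit.ResolutionOfSingularities.ResolutionOfSingularities.Theorems

open CategoryTheory AlgebraicGeometry TopologicalSpace Literature.AlgebraicGeometry.Resolution

universe u

/-! ## Closed immersions: stalks of `X` and of the image subscheme `i.ker.subscheme` -/

section ClosedImmersion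

variable {X Y : Scheme.{u}} (i : X ⟶ Y) [IsClosedImmersion i]

/-- For a closed immersion `i : X ⟶ Y`, the stalk of the image subscheme `V(ker i)` at `i x` is
regular iff the stalk of `X` at `x` is: `i.toImage : X ⟶ V(ker i)` is an isomorphism, so the stalk
map is a ring isomorphism. -/
theorem isRegularLocalRing_stalk_image_iff (x : X) :
    IsRegularLocalRing (i.image.presheaf.stalk (i.toImage x)) ↔
      IsRegularLocalRing (X.presheaf.stalk x) := by
  let e := (asIso (i.toImage.stalkMap x)).commRingCatIsoToRingEquiv
  exact ⟨fun _ => IsRegularLocalRing.of_ringEquiv e, fun _ => IsRegularLocalRing.of_ringEquiv e.symm⟩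

/-- For a closed immersion `i : X ⟶ Y`, `X` is regular iff the image subscheme `V(ker i)` (Mathlib's
`i.image = i.ker.subscheme`) is regular. -/
theorem isRegular_iff_isRegular_image :
    Scheme.IsRegular X ↔ Scheme.IsRegular i.image := by
  constructor
  · intro h x'
    obtain ⟨x, rfl⟩ := i.toImage.surjective x'
    exact (isRegularLocalRing_stalk_image_iff i x).mpr (h x)
  · intro h x
    exact (isRegularLocalRing_stalk_image_iff i x).mp (h (i.toImage x))

omit [IsClosedImmersion i] in
/-- The points of the image subscheme lying over `y` are the `i.toImage x` with `i x = y`. -/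
theorem toImage_apply_eq_iff (x : X) (y : Y) :
    i.ker.subschemeι (i.toImage x) = y ↔ i x = y := by
  rw [← Scheme.Hom.comp_apply]
  change (i.toImage ≫ i.imageι) x = y ↔ _
  rw [Scheme.Hom.toImage_imageι]

end ClosedImmersion

/-! ## The datum on a closed immersion: the resolved case -/

section Datum

variable {p : ℕ} (D : WeightedResolutionDatum p) {k : Type} [Field k] [CharP k p] [PerfectField k]
  {Y X : Scheme.{0}} (f : Y ⟶ Spec (.of k)) [Smooth f] [IsSeparated f] [QuasiCompact f]
  (i : X ⟶ Y) [IsClosedImmersion i]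

/-- **Axiom (ii) read on a closed immersion.** For a weighted resolution datum `D`, a smooth
separated quasi-compact `f : Y → Spec k` over a perfect field of characteristic `p` and a closed
immersion `i : X ⟶ Y`: the invariant of `(Y, ker i)` is everywhere minimal iff `X` is regular. -/
theorem isRegular_iff_forall_isBot_inv :
    Scheme.IsRegular X ↔ ∀ y : Y, IsBot (D.inv f i.ker y) := by
  rw [isRegular_iff_isRegular_image i]
  constructor
  · intro h y
    rw [D.isBot_inv_iff f i.ker y]
    intro x _
    exact h x
  · intro h x
    exact (D.isBot_inv_iff f i.ker (i.ker.subschemeι x)).mp (h _) x rfl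

/-- **The resolved case of `DatumToEmbedded`.** If the invariant of `(Y, ker i)` is everywhere
minimal then `X` is regular, hence is its own resolution. -/
theorem hasResolution_of_forall_isBot_inv (h : ∀ y : Y, IsBot (D.inv f i.ker y)) :
    Scheme.HasResolution X :=
  ((isRegular_iff_forall_isBot_inv D f i).mpr h).hasResolution

/-- **The guard of axioms (iii)/(iv).** If `X` is not regular, the invariant of `(Y, ker i)` is not
everywhere minimal. -/
theorem exists_not_isBot_inv_of_not_isRegular (h : ¬ Scheme.IsRegular X) :
    ∃ y : Y, ¬ IsBot (D.inv f i.ker y) := by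
  by_contra hcon
  push Not at hcon
  exact h ((isRegular_iff_forall_isBot_inv D f i).mpr hcon)

/-- A point `x` of `X` is a regular point iff the invariant of `(Y, ker i)` is minimal at `i x`. -/
theorem isBot_inv_apply_iff (x : X) :
    IsBot (D.inv f i.ker (i x)) ↔ IsRegularLocalRing (X.presheaf.stalk x) := by
  rw [D.isBot_inv_iff f i.ker (i x)]
  constructor
  · intro h
    exact (isRegularLocalRing_stalk_image_iff i x).mp (h (i.toImage x) ((toImage_apply_eq_iff i x _).mpr rfl))
  · intro h x' hx'
    obtain ⟨x₀, rfl⟩ := i.toImage.surjective x'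
    rw [toImage_apply_eq_iff] at hx'
    have hx₀ : x₀ = x := i.isClosedEmbedding.injective hx'
    subst hx₀
    exact (isRegularLocalRing_stalk_image_iff i x₀).mpr h

end Datum

/-! ## The invariant takes finitely many values and attains its maximum -/

section Max

variable {p : ℕ} (D : WeightedResolutionDatum p) {k : Type} [Field k] [CharP k p] [PerfectField k]
  {Y : Scheme.{0}} (f : Y ⟶ Spec (.of k)) [Smooth f] [IsSeparated f] [QuasiCompact f]

/-- A smooth quasi-compact scheme over a field is a Noetherian scheme (locally of finite type and
quasi-compact over a Noetherian affine base). -/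
theorem isNoetherian_of_smooth_quasiCompact {K : Type u} [Field K] {Z : Scheme.{u}}
    (g : Z ⟶ Spec (.of K)) [Smooth g] [QuasiCompact g] : IsNoetherian Z := by
  haveI : IsLocallyNoetherian Z := LocallyOfFiniteType.isLocallyNoetherian g
  haveI : CompactSpace Z := QuasiCompact.compactSpace_of_compactSpace g
  exact {}

/-- The invariant of a datum takes finitely many values on `(Y, X)` (`Y` smooth separated
quasi-compact over a perfect field): it is upper semicontinuous into a well-order and `|Y|` is
Noetherian. -/
theorem finite_range_inv (X : Y.IdealSheafData) : (Set.range (D.inv f X)).Finite := by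
  haveI : IsNoetherian Y := isNoetherian_of_smooth_quasiCompact f
  exact Literature.AlgGeom.finite_range_of_isClosed_superlevel (D.inv f X)
    (D.isClosed_superlevel f X)

/-- On a non-empty `Y` the invariant of a datum attains its maximum: the maximum locus blown up by
axioms (iii)/(iv) is non-empty. -/
theorem exists_isMax_inv [Nonempty Y] (X : Y.IdealSheafData) :
    ∃ y : Y, ∀ y' : Y, D.inv f X y' ≤ D.inv f X y := by
  haveI : IsNoetherian Y := isNoetherian_of_smooth_quasiCompact f
  exact Literature.AlgGeom.exists_max_of_isClosed_superlevel (D.inv f X)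
    (D.isClosed_superlevel f X)

/-- The maximum locus of the invariant is closed (it is the superlevel set of the maximal value,
or empty). -/
theorem isClosed_maxLocus_inv (X : Y.IdealSheafData) :
    IsClosed {y : Y | ∀ y' : Y, D.inv f X y' ≤ D.inv f X y} := by
  by_cases hY : Nonempty Y
  · obtain ⟨y₀, hy₀⟩ := exists_isMax_inv D f X
    have : {y : Y | ∀ y' : Y, D.inv f X y' ≤ D.inv f X y} = {y : Y | D.inv f X y₀ ≤ D.inv f X y} := by
      ext y
      simp only [Set.mem_setOf_eq]
      exact ⟨fun h => h y₀, fun h y' => (hy₀ y').trans h⟩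
    rw [this]
    exact D.isClosed_superlevel f X _
  · haveI : IsEmpty Y := not_nonempty_iff.mp hY
    have : {y : Y | ∀ y' : Y, D.inv f X y' ≤ D.inv f X y} = ∅ := Set.eq_empty_of_isEmpty _
    rw [this]
    exact isClosed_empty

end Max


/-! ## Well-founded induction on the maximum of the invariant -/

section Induction

variable {p : ℕ} (D : WeightedResolutionDatum p) {k : Type} [Field k] [CharP k p] [PerfectField k]

/-- **The induction engine of the weighted algorithm** (shape of Abramovich–Temkin–Włodarczyk 2024,
proof of Thm. 1.1.1, and Włodarczyk 2022, §3.3.33: "by induction on `maxinv`"). Let `Q` be a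
property of pairs `(f : Y → Spec k, I)` (`Y` smooth separated quasi-compact over the perfect field
`k`, `I` an ideal sheaf on `Y`). Suppose `Q` holds whenever the invariant of the datum `D` is
everywhere minimal (the resolved case), and that `Q` holds for `(f, I)` with a point `y₀` of maximal,
non-minimal invariant as soon as it holds for every pair whose invariant is everywhere strictly below
`inv y₀`. Then `Q` holds for every pair: the values `max inv` live in the well-ordered `D.Γ`
(`exists_isMax_inv`), so this is well-founded induction on `max inv`. -/
theorem WeightedResolutionDatum.maxinv_induction
    (Q : ∀ (Y : Scheme.{0}), (Y ⟶ Spec (.of k)) → Y.IdealSheafData → Prop)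
    (base : ∀ (Y : Scheme.{0}) (f : Y ⟶ Spec (.of k)) [Smooth f] [IsSeparated f] [QuasiCompact f]
      (I : Y.IdealSheafData), (∀ y : Y, IsBot (D.inv f I y)) → Q Y f I)
    (step : ∀ (Y : Scheme.{0}) (f : Y ⟶ Spec (.of k)) [Smooth f] [IsSeparated f] [QuasiCompact f]
      (I : Y.IdealSheafData) (y₀ : Y), ¬ IsBot (D.inv f I y₀) →
      (∀ y : Y, D.inv f I y ≤ D.inv f I y₀) →
      (∀ (Y₁ : Scheme.{0}) (f₁ : Y₁ ⟶ Spec (.of k)) [Smooth f₁] [IsSeparated f₁] [QuasiCompact f₁]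
        (I₁ : Y₁.IdealSheafData), (∀ y₁ : Y₁, D.inv f₁ I₁ y₁ < D.inv f I y₀) → Q Y₁ f₁ I₁) →
      Q Y f I)
    (Y : Scheme.{0}) (f : Y ⟶ Spec (.of k)) [Smooth f] [IsSeparated f] [QuasiCompact f]
    (I : Y.IdealSheafData) : Q Y f I := by
  -- the statement bounded by `γ`, proved by well-founded induction on `γ ∈ D.Γ`
  have key : ∀ γ : D.Γ, ∀ (Y : Scheme.{0}) (f : Y ⟶ Spec (.of k)) [Smooth f] [IsSeparated f]
      [QuasiCompact f] (I : Y.IdealSheafData), (∀ y : Y, D.inv f I y ≤ γ) → Q Y f I := by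
    intro γ
    induction γ using WellFoundedLT.induction with
    | ind γ ih =>
      intro Y f _ _ _ I hγ
      by_cases hbot : ∀ y : Y, IsBot (D.inv f I y)
      · exact base Y f I hbot
      · push Not at hbot
        obtain ⟨y₁, hy₁⟩ := hbot
        haveI : Nonempty Y := ⟨y₁⟩
        obtain ⟨y₀, hy₀⟩ := exists_isMax_inv D f I
        refine step Y f I y₀ (D.not_isBot_of_isMaxOn f I ⟨y₁, hy₁⟩ hy₀) hy₀ ?_
        intro Y₁ f₁ _ _ _ I₁ hlt
        by_cases hbot₁ : ∀ y : Y₁, IsBot (D.inv f₁ I₁ y)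
        · exact base Y₁ f₁ I₁ hbot₁
        · push Not at hbot₁
          obtain ⟨z₁, _⟩ := hbot₁
          haveI : Nonempty Y₁ := ⟨z₁⟩
          obtain ⟨z₀, hz₀⟩ := exists_isMax_inv D f₁ I₁
          exact ih (D.inv f₁ I₁ z₀) ((hlt z₀).trans_le (hy₀ y₀ |>.trans (hγ y₀))) Y₁ f₁ I₁ hz₀
  by_cases hbot : ∀ y : Y, IsBot (D.inv f I y)
  · exact base Y f I hbot
  · push Not at hbot
    obtain ⟨y₁, _⟩ := hbot
    haveI : Nonempty Y := ⟨y₁⟩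
    obtain ⟨y₀, hy₀⟩ := exists_isMax_inv D f I
    exact key (D.inv f I y₀) Y f I hy₀

end Induction

end Summit.ResolutionOfSingularities.ResolutionOfSingularities.Theorems
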